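import Mathlib.NumberTheory.JacobiSum.Basic
import Mathlib.NumberTheory.LegendreSymbol.QuadraticChar.Basic
import Mathlib.Analysis.SpecialFunctions.Pow.Real
import Mathlib.Algebra.Order.Chebyshev
import HarnessLib

/-!
# Lindsey's lemma for the Paley graph: `|∑_{s∈S,t∈T} χ(s − t)| ≤ √(p·|S|·|T|)`

For an odd prime `p` and the quadratic character `χ` of `𝔽_p` (Mathlib's `quadraticChar (ZMod p)`),
the character sum over any product of vertex sets `S × T ⊆ 𝔽_p²` satisfies

  `|∑_{s ∈ S} ∑_{t ∈ T} χ(s − t)| ≤ √(p · |S| · |T|)`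

(B. Chor, O. Goldreich, *Unbiased bits from sources of weak randomness and probabilistic communication
complexity*, SIAM J. Comput. 17 (1988), §3 — the bound behind their two-source extractor above
min-entropy rate `1/2`; "Lindsey's lemma" for the `±1` Paley matrix).  Proof (the one in print):
Cauchy–Schwarz in `t`, then the second moment over ALL `t ∈ 𝔽_p`,
`∑_t (∑_{s∈S} χ(s−t))² = p|S| − |S|²`, from the correlation identity `∑_t χ(t−a)χ(t−b) = −1` (`a ≠ b`),
itself the Jacobi sum `J(χ, χ⁻¹) = −χ(−1)` of Mathlib (`jacobiSum_nontrivial_inv`) after the affine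
change of variables `t = a + (b−a)x`.

* `sum_quadraticChar_sub_mul_quadraticChar_sub` — `∑_t χ(t−a)χ(t−b) = −1` for `a ≠ b`;
* `sum_sq_quadraticCharSum` — `∑_{t∈𝔽_p} (∑_{s∈S} χ(s−t))² = p|S| − |S|²`;
* `abs_quadraticCharSum_le` — **Lindsey's lemma** as displayed above.

This is the "`α > 1/2`" half of the Paley graph conjecture (power saving as soon as `|S||T| > p^{1+ε}`);
nothing beyond the square-root barrier is claimed.  Design: sets are `Finset (ZMod p)`, the character
is cast to `ℝ`; `p ≠ 2` is assumed where the identities need it (for `p = 2` the character is trivial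
on units).
-/

namespace Literature.NumberTheory.GaussSums

open Finset
open scoped BigOperators

section Lindsey

variable {p : ℕ} [Fact p.Prime]

/-- `ringChar (ZMod p) ≠ 2` for an odd prime `p`. [folklore] -/
private theorem ringChar_zmod_ne_two (hp : p ≠ 2) : ringChar (ZMod p) ≠ 2 := by
  rw [ZMod.ringChar_zmod_n]; exact hp

/-- **Correlation of the quadratic character**: `∑_{t ∈ 𝔽_p} χ(t − a)·χ(t − b) = −1` for `a ≠ b`
(`p` odd).  Proof: `t = a + (b − a)x` turns the sum into `χ(−1)·J(χ, χ) = χ(−1)·(−χ(−1)) = −1`.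
[cite: ChorGoldreich1988, §3] -/
theorem sum_quadraticChar_sub_mul_quadraticChar_sub (hp : p ≠ 2) {a b : ZMod p} (hab : a ≠ b) :
    ∑ t : ZMod p, quadraticChar (ZMod p) (t - a) * quadraticChar (ZMod p) (t - b) = -1 := by
  set χ := quadraticChar (ZMod p) with hχ
  have hF := ringChar_zmod_ne_two hp
  have hba : b - a ≠ 0 := sub_ne_zero.2 (Ne.symm hab)
  -- Jacobi sum `J(χ, χ⁻¹) = -χ(-1)` with `χ⁻¹ = χ`
  have hJ : ∑ x : ZMod p, χ x * χ (1 - x) = -χ (-1) := by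
    have h := jacobiSum_nontrivial_inv (R := ℤ) (quadraticChar_ne_one hF)
    rw [(quadraticChar_isQuadratic (ZMod p)).inv] at h
    exact h
  -- affine change of variables `t = a + (b - a) * x`
  have hbij : Function.Bijective (fun x : ZMod p => a + (b - a) * x) := by
    refine (Finite.injective_iff_bijective).1 fun x y hxy => ?_
    have : (b - a) * x = (b - a) * y := by simpa using hxy
    exact mul_left_cancel₀ hba this
  rw [← Function.Bijective.sum_comp hbij (fun t => χ (t - a) * χ (t - b))]
  have hterm : ∀ x : ZMod p, χ (a + (b - a) * x - a) * χ (a + (b - a) * x - b) =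
      χ (-1) * (χ x * χ (1 - x)) := by
    intro x
    have e1 : a + (b - a) * x - a = (b - a) * x := by ring
    have e2 : a + (b - a) * x - b = (b - a) * (-1) * (1 - x) := by ring
    rw [e1, e2, map_mul, map_mul, map_mul]
    have hsq : χ (b - a) * χ (b - a) = 1 := by rw [← sq]; exact quadraticChar_sq_one hba
    calc χ (b - a) * χ x * (χ (b - a) * χ (-1) * χ (1 - x))
        = (χ (b - a) * χ (b - a)) * (χ (-1) * (χ x * χ (1 - x))) := by ring
      _ = χ (-1) * (χ x * χ (1 - x)) := by rw [hsq, one_mul]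
  simp_rw [hterm]
  rw [← mul_sum, hJ]
  have hm1 : χ (-1) * χ (-1) = 1 := by rw [← sq]; exact quadraticChar_sq_one (neg_ne_zero.2 one_ne_zero)
  linear_combination (-1 : ℤ) * hm1

/-- `∑_{t ∈ 𝔽_p} χ(t − a)² = p − 1` (every non-zero value of `χ` is `±1`). [folklore] -/
private theorem sum_quadraticChar_sub_sq (a : ZMod p) :
    ∑ t : ZMod p, quadraticChar (ZMod p) (t - a) * quadraticChar (ZMod p) (t - a) = (p : ℤ) - 1 := by
  classical
  have hterm : ∀ t : ZMod p, quadraticChar (ZMod p) (t - a) * quadraticChar (ZMod p) (t - a) =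
      if t = a then 0 else 1 := by
    intro t
    split_ifs with h
    · rw [h, sub_self, quadraticChar_zero, mul_zero]
    · rw [← sq]; exact quadraticChar_sq_one (sub_ne_zero.2 h)
  simp_rw [hterm]
  rw [Finset.sum_ite, sum_const_zero, zero_add, sum_const, nsmul_eq_mul, mul_one]
  have : (Finset.univ.filter (fun t : ZMod p => ¬t = a)) = Finset.univ.erase a := by
    ext t; simp [mem_erase, and_comm]
  rw [this, card_erase_of_mem (mem_univ a), card_univ, ZMod.card]
  have h1 : 1 ≤ p := (Fact.out : p.Prime).one_lt.le
  push_cast [Nat.cast_sub h1]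
  ring

/-- **Second moment**: `∑_{t ∈ 𝔽_p} (∑_{s ∈ S} χ(s − t))² = p·|S| − |S|²` (`p` odd).
[cite: ChorGoldreich1988, §3] -/
theorem sum_sq_quadraticCharSum (hp : p ≠ 2) (S : Finset (ZMod p)) :
    ∑ t : ZMod p, (∑ s ∈ S, ((quadraticChar (ZMod p) (s - t) : ℤ) : ℝ)) ^ 2 =
      (p : ℝ) * S.card - (S.card : ℝ) ^ 2 := by
  classical
  set χ := quadraticChar (ZMod p) with hχ
  -- `χ(s - t) = χ(-1) χ(t - s)`, so products of two such factors lose the sign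
  have hflip : ∀ s s' t : ZMod p, χ (s - t) * χ (s' - t) = χ (t - s) * χ (t - s') := by
    intro s s' t
    have e1 : s - t = (-1) * (t - s) := by ring
    have e2 : s' - t = (-1) * (t - s') := by ring
    rw [e1, e2, map_mul, map_mul]
    have hm1 : χ (-1) * χ (-1) = 1 := by
      rw [← sq]; exact quadraticChar_sq_one (neg_ne_zero.2 one_ne_zero)
    linear_combination (χ (t - s) * χ (t - s')) * hm1
  -- expand the square and swap sums
  have hexp : ∀ t : ZMod p, (∑ s ∈ S, ((χ (s - t) : ℤ) : ℝ)) ^ 2 =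
      ∑ s ∈ S, ∑ s' ∈ S, (((χ (t - s) * χ (t - s') : ℤ) : ℝ)) := by
    intro t
    rw [sq, sum_mul_sum]
    refine sum_congr rfl fun s _ => sum_congr rfl fun s' _ => ?_
    rw [← hflip s s' t]; push_cast; ring
  simp_rw [hexp]
  rw [sum_comm]
  have hinner : ∀ s ∈ S, ∑ t : ZMod p, ∑ s' ∈ S, (((χ (t - s) * χ (t - s') : ℤ) : ℝ)) =
      (p : ℝ) - 1 - ((S.card : ℝ) - 1) := by
    intro s hs
    rw [sum_comm]
    rw [← add_sum_erase S _ hs]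
    have hdiag : ∑ t : ZMod p, (((χ (t - s) * χ (t - s) : ℤ) : ℝ)) = (p : ℝ) - 1 := by
      rw [show ∑ t : ZMod p, (((χ (t - s) * χ (t - s) : ℤ) : ℝ)) =
        ((∑ t : ZMod p, χ (t - s) * χ (t - s) : ℤ) : ℝ) by push_cast; rfl]
      rw [sum_quadraticChar_sub_sq s]; push_cast; ring
    have hoff : ∑ s' ∈ S.erase s, ∑ t : ZMod p, (((χ (t - s) * χ (t - s') : ℤ) : ℝ)) =
        -((S.card : ℝ) - 1) := by
      have h1 : ∀ s' ∈ S.erase s, ∑ t : ZMod p, (((χ (t - s) * χ (t - s') : ℤ) : ℝ)) = -1 := by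
        intro s' hs'
        rw [show ∑ t : ZMod p, (((χ (t - s) * χ (t - s') : ℤ) : ℝ)) =
          ((∑ t : ZMod p, χ (t - s) * χ (t - s') : ℤ) : ℝ) by push_cast; rfl]
        rw [sum_quadraticChar_sub_mul_quadraticChar_sub hp (ne_of_mem_erase hs').symm]
        push_cast; ring
      rw [sum_congr rfl h1, sum_const, card_erase_of_mem hs, nsmul_eq_mul, mul_neg, mul_one]
      have hc : 1 ≤ S.card := card_pos.2 ⟨s, hs⟩
      push_cast [Nat.cast_sub hc]
      ring
    rw [hdiag, hoff]; ring
  rw [sum_congr rfl hinner, sum_const, nsmul_eq_mul]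
  ring

/-- **Lindsey's lemma for the Paley graph** (Chor–Goldreich 1988): for every odd prime `p` and all
`S, T ⊆ 𝔽_p`, `|∑_{s∈S} ∑_{t∈T} χ(s − t)| ≤ √(p · |S| · |T|)`.  Cauchy–Schwarz over `t ∈ T` and the
second moment `sum_sq_quadraticCharSum`. [cite: ChorGoldreich1988, §3] -/
theorem abs_quadraticCharSum_le (hp : p ≠ 2) (S T : Finset (ZMod p)) :
    |∑ s ∈ S, ∑ t ∈ T, ((quadraticChar (ZMod p) (s - t) : ℤ) : ℝ)| ≤
      Real.sqrt ((p : ℝ) * S.card * T.card) := by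
  classical
  set f : ZMod p → ℝ := fun t => ∑ s ∈ S, ((quadraticChar (ZMod p) (s - t) : ℤ) : ℝ) with hf
  have hswap : ∑ s ∈ S, ∑ t ∈ T, ((quadraticChar (ZMod p) (s - t) : ℤ) : ℝ) = ∑ t ∈ T, f t := by
    rw [sum_comm]
  rw [hswap]
  -- Cauchy–Schwarz: `(∑_{t∈T} f t)² ≤ |T| · ∑_{t∈T} f(t)² ≤ |T| · ∑_{t∈𝔽_p} f(t)² = |T|(p|S| − |S|²)`
  have hCS : (∑ t ∈ T, f t) ^ 2 ≤ (T.card : ℝ) * ∑ t ∈ T, f t ^ 2 := sq_sum_le_card_mul_sum_sq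
  have hsub : ∑ t ∈ T, f t ^ 2 ≤ ∑ t : ZMod p, f t ^ 2 :=
    sum_le_sum_of_subset_of_nonneg (subset_univ T) fun t _ _ => sq_nonneg (f t)
  have hmom : ∑ t : ZMod p, f t ^ 2 = (p : ℝ) * S.card - (S.card : ℝ) ^ 2 :=
    sum_sq_quadraticCharSum hp S
  have hsq : (∑ t ∈ T, f t) ^ 2 ≤ (p : ℝ) * S.card * T.card := by
    have hT0 : (0 : ℝ) ≤ T.card := Nat.cast_nonneg _
    have hS2 : (0 : ℝ) ≤ (S.card : ℝ) ^ 2 := sq_nonneg _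
    calc (∑ t ∈ T, f t) ^ 2 ≤ (T.card : ℝ) * ∑ t ∈ T, f t ^ 2 := hCS
      _ ≤ (T.card : ℝ) * ∑ t : ZMod p, f t ^ 2 := mul_le_mul_of_nonneg_left hsub hT0
      _ = (T.card : ℝ) * ((p : ℝ) * S.card - (S.card : ℝ) ^ 2) := by rw [hmom]
      _ ≤ (p : ℝ) * S.card * T.card := by nlinarith
  rw [← Real.sqrt_sq_eq_abs]
  exact Real.sqrt_le_sqrt hsq

end Lindsey

end Literature.NumberTheory.GaussSums
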